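import Summits.ResolutionOfSingularities.ResolutionOfSingularities.Theorems.FrobeniusClosingSteerStrippedThreadGerm
import Mathlib.Algebra.CharP.Lemmas
import Mathlib.Algebra.CharP.Subring
import HarnessLib

/-!
# Stripped threads, part 2: a height-one hit of the thread strips the fresh exceptional divisor

W4.1, crux `Steer` (stmt-ResolutionOfSingularities-16345), σ-line, §σ2.25 v2.1 piece F-A3 `StrippedThreadTwoN` (Θ1♭, res-L0-w41-plan-1
RULING 36 «THIS identification is the one new lemma»; owner res-D-pv-003, consult res-D-pv-011). Theses-free, def-free; sequel of
`…StrippedThreadLemmas` (p520316) and `…StrippedThreadGerm`.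

## The setting (one block of a stripped thread)

A visit of the thread blows up the regular member `R v` along the thread centre `P v` (a σ_top-permissible centre: `P v ≤ 𝔪`, `R v ⧸ P v`
regular), with exceptional parameter `ξ`; `R (v+1)` is the new member and `G = (R (v+1))_{W (v+1)} ⊆ K` the THREAD GERM (`W (v+1) ∩ R v = P v`).
At a later stage `m` of the same block the germ has not moved (`G = (R m)_{W m}`, identity and divisor steps — part 1 and pv-011's
p514807), and the accumulated strict-transform bookkeeping reads `s v = U · ξ^(n+1) · s m + B` with `U` a unit of `G` and `B ∈ R m`. A HIT at
`m` is a σ_top centre `P m ≤ W m` of height one (part 1: `≠ ⊥`) which is a SINGULAR prime of the radicand `s m ^ p`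
(`IsSingPrime (R m) p (s m ^ p) (P m)` of the skeleton, unfolded).

## The lemma (`excParam_hit_eq_mul_unit`)

**The exceptional parameter `x m` of such a hit is `ξ · u` with `u` a unit of the germ** — the hit strips the fresh exceptional divisor
`E = V(ξ)` of the visit. Proof: `P m = (π)` and `x m = π · a`, `a` a unit of `R m` (part 1). If `ξ ∈ P m` then `π ∣ ξ` in `G`, where `ξ` is a
PRIME ELEMENT (`prime_excParam_germ`) and `π` a non-unit: so `π` and `ξ` are associates. If `ξ ∉ P m`, the local ring `D = (R m)_{P m}` of the
hit equals `G_𝔮 = (R (v+1))_{Q₁} = (R v)_{Q'}` inside `K` (localisation of a localisation twice, then «a local blowing up is an isomorphism off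
the exceptional prime», part 1, since `ξ ∉ Q₁`), with `Q' < P v` (`ξ ∈ P v ∖ Q'`); MINIMALITY of the thread centre among the singular primes at
the visit (`IsTopSingComponent`) makes `T^p = s v^p` regular over `D`, and `s m^p = (U ξ^(n+1))^(−p) · s v^p + (−B/(U ξ^(n+1)))^p` is a UNIT
rescaling over `D` (`ξ ∉ 𝔪_D`), so `T^p = s m^p` is regular over `D` as well (pv-011's `isRegularLocalRing_adjoinRoot_rescale`) — contradicting
the singularity of the hit. OURS (the W4.1 engine). [cite: Matsumura1987, Thm. 14.2, Thm. 19.3, Thm. 20.3] [cite: Cutkosky2014, §2.1]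
[cite: NovacoskiSpivakovsky2014, Def. 2.11]
-/

noncomputable section

-- `Summit.<S>.<S>.…` duplicates the summit name by design (single-problem summit).
set_option linter.dupNamespace false

open Polynomial IsLocalRing Literature.AlgebraicGeometry.Resolution

namespace Summit.ResolutionOfSingularities.ResolutionOfSingularities.Theorems.SwitchingDichotomy.StrippedThread

variable {K : Type} [Field K]

/-! ## §1 A tower of localisations inside `K` -/

/-- **Localisation of a localisation, tower form**: if `G = R_W ⊆ K` and `D = G_𝔮 ⊆ K` for a prime `𝔮` of `G`, then `D = R_{Q₁}` for
`Q₁ = 𝔪_D ∩ R`. [folklore] -/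
theorem locChar_trans {R G D : Subring K} {W : Ideal R} [hW : W.IsPrime]
    (hG : ∀ z : K, z ∈ G ↔ ∃ a b : R, b ∉ W ∧ z = (a : K) / b)
    {𝔮 : Ideal G} [h𝔮 : 𝔮.IsPrime] (hD : ∀ z : K, z ∈ D ↔ ∃ a b : G, b ∉ 𝔮 ∧ z = (a : K) / b) [IsLocalRing D] :
    ∀ z : K, z ∈ D ↔ ∃ a b : R, b ∉ (maximalIdeal D).comap
      (Subring.inclusion ((GeoDict.le_of_locChar hG).trans (GeoDict.le_of_locChar hD))) ∧ z = (a : K) / b := by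
  have hRG : R ≤ G := GeoDict.le_of_locChar hG
  have hGD : G ≤ D := GeoDict.le_of_locChar hD
  -- non-zero elements with inverse in `D` are outside `𝔪_D`
  have hunitD : ∀ (z : K) (hz : z ∈ D), z ≠ 0 → z⁻¹ ∈ D → (⟨z, hz⟩ : D) ∉ maximalIdeal D := by
    intro z hz hz0 hzinv hmem
    exact (IsLocalRing.mem_maximalIdeal _).mp hmem ((isUnit_subring_iff_inv_mem _).mpr ⟨hz0, hzinv⟩)
  have hinvG : ∀ b : R, b ∉ W → ((b : K))⁻¹ ∈ G := fun b hb => by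
    rw [← one_div]
    exact (hG _).mpr ⟨1, b, hb, by simp⟩
  have hinvD : ∀ b : G, b ∉ 𝔮 → ((b : K))⁻¹ ∈ D := fun b hb => by
    rw [← one_div]
    exact (hD _).mpr ⟨1, b, hb, by simp⟩
  intro z
  constructor
  · intro hz
    obtain ⟨a, b, hb, rfl⟩ := (hD z).mp hz
    obtain ⟨a₁, a₂, ha₂, ha⟩ := (hG a).mp a.2
    obtain ⟨b₁, b₂, hb₂, hbb⟩ := (hG b).mp b.2
    have ha₂0 : (a₂ : K) ≠ 0 := GeoDict.coe_ne_zero_of_not_mem ha₂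
    have hb₂0 : (b₂ : K) ≠ 0 := GeoDict.coe_ne_zero_of_not_mem hb₂
    have hb0 : (b : K) ≠ 0 := GeoDict.coe_ne_zero_of_not_mem hb
    have hb₁0 : (b₁ : K) ≠ 0 := by
      intro h
      apply hb0
      rw [hbb, h, zero_div]
    refine ⟨a₁ * b₂, a₂ * b₁, ?_, ?_⟩
    · -- `a₂ b₁` is a unit of `D`
      rw [Ideal.mem_comap]
      have ha₂D : ((a₂ : K))⁻¹ ∈ D := hGD (hinvG a₂ ha₂)
      have hb₁inv : ((b₁ : K))⁻¹ ∈ D := by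
        -- `b₁ = b · b₂`, both units of `D`
        have : ((b₁ : K))⁻¹ = ((b : K))⁻¹ * ((b₂ : K))⁻¹ := by
          rw [hbb, inv_div]
          field_simp
        rw [this]
        exact D.mul_mem (hinvD b hb) (hGD (hinvG b₂ hb₂))
      have hprod : ((((a₂ * b₁ : R) : K)))⁻¹ ∈ D := by
        rw [Subring.coe_mul, mul_inv]
        exact D.mul_mem ha₂D hb₁inv
      exact hunitD _ (hGD (hRG (a₂ * b₁).2)) (by rw [Subring.coe_mul]; exact mul_ne_zero ha₂0 hb₁0) hprod
    · rw [ha, hbb, Subring.coe_mul, Subring.coe_mul]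
      field_simp
  · rintro ⟨a, b, hb, rfl⟩
    rw [Ideal.mem_comap] at hb
    have hbu : IsUnit (Subring.inclusion (hRG.trans hGD) b) := by
      by_contra h
      exact hb ((IsLocalRing.mem_maximalIdeal _).mpr h)
    have hbinv : ((b : K))⁻¹ ∈ D := ((isUnit_subring_iff_inv_mem _).mp hbu).2
    rw [div_eq_mul_inv]
    exact D.mul_mem (hGD (hRG a.2)) hbinv

/-! ## §2 The hit lemma -/

section Hit

variable (p : ℕ) [hp : Fact p.Prime] [CharP K p]
  {O : ValuationSubring K}
  -- the visit: `R v → R (v+1)` along the thread centre `P v`, exceptional parameter `ξ`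
  {Rv Rv1 : Subring K} [IsRegularLocalRing Rv] {Pv : Ideal Rv}
  -- the thread germ after the visit, the later member `R m` and its thread prime `W m`
  {Wv1 : Ideal Rv1} [hWv1 : Wv1.IsPrime] {G : Subring K}
  {Rm : Subring K} [IsRegularLocalRing Rm] {Wm Pm : Ideal Rm} [hWm : Wm.IsPrime] [hPm : Pm.IsPrime]

/-- **A height-one hit of the thread strips the fresh exceptional divisor: its exceptional parameter is `ξ · unit` in the germ.**
See the module docstring for the setting and the proof. Hypotheses: `hval`/`hP`/regular quotient/`hbl`/`hξ` describe the visit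
(a local blowing up of the regular member `R v`, dominated by `O`, along the permissible centre `P v` with exceptional parameter `ξ`);
`hG1`/`hGm` say that `G` is the thread germ read on `R (v+1)` (`W (v+1) ∋ ξ`) and on the later member `R m` (`R v ≤ R m`,
`W m ∩ R v = P v`); `hlocm`/`hP1`/`hPW`/`hsing`/`hxm` describe the HIT (`P m ≤ W m` of height one, singular for `s m ^ p`, exceptional
parameter `x m`); `hrel` is the block bookkeeping `s v = U · ξ^(n+1) · s m + B` (`U` a unit of `G`, `B ∈ R m`); `hmin` is the minimality of
the thread centre among the singular primes of `s v ^ p` at the visit. OURS (the W4.1 engine).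
[cite: Matsumura1987, Thm. 14.2, Thm. 19.3, Thm. 20.3] [cite: Cutkosky2014, §2.1] [cite: NovacoskiSpivakovsky2014, Def. 2.11] -/
theorem excParam_hit_eq_mul_unit
    (hval : ∀ a : Rv, a ∈ maximalIdeal Rv ↔ O.valuation (a : K) < 1)
    (hP : Pv ≤ maximalIdeal Rv) [IsRegularLocalRing (Rv ⧸ Pv)]
    (hbl : IsLocalBlowupAlong O Rv Pv Rv1) {ξ : K}
    (hξ : (∃ hξR : ξ ∈ Rv, (⟨ξ, hξR⟩ : Rv) ∈ Pv) ∧ ξ ≠ 0 ∧ ∀ y : Rv, y ∈ Pv → O.valuation (y : K) ≤ O.valuation ξ)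
    (hG1 : ∀ z : K, z ∈ G ↔ ∃ a b : Rv1, b ∉ Wv1 ∧ z = (a : K) / b)
    (hξW : ∃ hξR1 : ξ ∈ Rv1, (⟨ξ, hξR1⟩ : Rv1) ∈ Wv1)
    (hGm : ∀ z : K, z ∈ G ↔ ∃ a b : Rm, b ∉ Wm ∧ z = (a : K) / b)
    (hRvm : Rv ≤ Rm) (hWmv : Wm.comap (Subring.inclusion hRvm) = Pv)
    (hRmO : Rm ≤ O.toSubring) (hlocm : locAtCentre Rm O = Rm)
    (hP1 : Pm.height = 1) (hPW : Pm ≤ Wm)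
    {sm : K} (hsm : sm ^ p ∈ Rm)
    (hsing : ¬ IsRegularLocalRing (AdjoinRoot ((X : (Localization.AtPrime Pm)[X]) ^ p -
      C (algebraMap Rm (Localization.AtPrime Pm) ⟨sm ^ p, hsm⟩))))
    {xm : K}
    (hxm : (∃ hxR : xm ∈ Rm, (⟨xm, hxR⟩ : Rm) ∈ Pm) ∧ xm ≠ 0 ∧ ∀ y : Rm, y ∈ Pm → O.valuation (y : K) ≤ O.valuation xm)
    {sv : K} (hsv : sv ^ p ∈ Rv) {U B : K} (hU : U ∈ G) (hUinv : U⁻¹ ∈ G) (hU0 : U ≠ 0) (hB : B ∈ Rm) {n : ℕ}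
    (hrel : sv = U * ξ ^ (n + 1) * sm + B)
    (hmin : ∀ (Q : Ideal Rv) [Q.IsPrime], Q < Pv →
      IsRegularLocalRing (AdjoinRoot ((X : (Localization.AtPrime Q)[X]) ^ p -
        C (algebraMap Rv (Localization.AtPrime Q) ⟨sv ^ p, hsv⟩)))) :
    ∃ u : K, u ∈ G ∧ u⁻¹ ∈ G ∧ xm = ξ * u := by
  have hξRv : ξ ∈ Rv := hξ.1.fst
  have hξPv : (⟨ξ, hξRv⟩ : Rv) ∈ Pv := hξ.1.snd
  have hξ0 : ξ ≠ 0 := hξ.2.1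
  have hξRm : ξ ∈ Rm := hRvm hξRv
  have hRmG : Rm ≤ G := GeoDict.le_of_locChar hGm
  haveI : IsLocalRing G := GeoDict.isLocalRing_of_locChar hGm
  -- the hit: `P m = (π)`, `x m = π · a`
  obtain ⟨π, hPπ, -, a, haR, hainv, hxa⟩ := excParam_eq_mul_of_divisorStep hRmO hlocm hP1 hxm
  have hπP : π ∈ Pm := hPπ ▸ Ideal.mem_span_singleton_self π
  -- `π` is a non-unit of `G`
  have hπG : ((π : Rm) : K) ∈ G := hRmG π.2
  have hπmax : (⟨(π : K), hπG⟩ : G) ∈ maximalIdeal G := by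
    rw [GeoDict.mem_maximalIdeal_iff_of_locChar hGm]
    exact ⟨π, 1, hPW hπP, fun h => hWm.ne_top (Wm.eq_top_of_isUnit_mem h isUnit_one), by simp⟩
  by_cases hξP : (⟨ξ, hξRm⟩ : Rm) ∈ Pm
  · -- ### CASE `ξ ∈ P m`: `π ∣ ξ` with `ξ` prime in `G`
    have hprime : Prime (⟨ξ, GeoDict.le_of_locChar hG1 hξW.fst⟩ : G) :=
      prime_excParam_germ hval hP hbl hξ hG1 hξW
    rw [hPπ] at hξP
    obtain ⟨r, hr⟩ := Ideal.mem_span_singleton'.mp hξP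
    -- in `G`: `ξ = r · π`
    have hrG : ((r : Rm) : K) ∈ G := hRmG r.2
    have heqG : (⟨ξ, GeoDict.le_of_locChar hG1 hξW.fst⟩ : G) = ⟨(r : K), hrG⟩ * ⟨(π : K), hπG⟩ := by
      apply Subtype.ext
      change ξ = (r : K) * π
      have := congrArg (fun t : Rm => (t : K)) hr
      simpa using this.symm
    have hdvd : (⟨ξ, GeoDict.le_of_locChar hG1 hξW.fst⟩ : G) ∣ ⟨(r : K), hrG⟩ * ⟨(π : K), hπG⟩ := ⟨1, by rw [← heqG, mul_one]⟩
    rcases hprime.dvd_or_dvd hdvd with ⟨t, ht⟩ | ⟨t, ht⟩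
    · -- `r = ξ t` ⇒ `ξ = ξ t π` ⇒ `t π = 1` ⇒ `π` unit: contradiction
      exfalso
      have h1 : (⟨ξ, GeoDict.le_of_locChar hG1 hξW.fst⟩ : G) * (1 - t * ⟨(π : K), hπG⟩) = 0 :=
        calc (⟨ξ, GeoDict.le_of_locChar hG1 hξW.fst⟩ : G) * (1 - t * ⟨(π : K), hπG⟩)
            = ⟨ξ, GeoDict.le_of_locChar hG1 hξW.fst⟩ - (⟨ξ, GeoDict.le_of_locChar hG1 hξW.fst⟩ * t) * ⟨(π : K), hπG⟩ := by
              ring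
          _ = 0 := by rw [← ht, ← heqG, sub_self]
      have hξ0G : (⟨ξ, GeoDict.le_of_locChar hG1 hξW.fst⟩ : G) ≠ 0 := fun h => hξ0 (congrArg Subtype.val h)
      have h2 : 1 - t * ⟨(π : K), hπG⟩ = 0 := (mul_eq_zero.mp h1).resolve_left hξ0G
      have hmul : (⟨(π : K), hπG⟩ : G) * t = 1 := by
        rw [mul_comm]; exact (sub_eq_zero.mp h2).symm
      have hunit : IsUnit (⟨(π : K), hπG⟩ : G) := isUnit_iff_exists_inv.mpr ⟨t, hmul⟩
      exact (IsLocalRing.mem_maximalIdeal _).mp hπmax hunit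
    · -- `π = ξ t` ⇒ `ξ = r ξ t` ⇒ `r t = 1`: `x m = π a = ξ (t a)` with `t a` a unit of `G`
      have hξ0G : (⟨ξ, GeoDict.le_of_locChar hG1 hξW.fst⟩ : G) ≠ 0 := fun h => hξ0 (congrArg Subtype.val h)
      have hrt : ⟨(r : K), hrG⟩ * t = 1 := by
        have h1 : (⟨ξ, GeoDict.le_of_locChar hG1 hξW.fst⟩ : G) * (1 - ⟨(r : K), hrG⟩ * t) = 0 :=
          calc (⟨ξ, GeoDict.le_of_locChar hG1 hξW.fst⟩ : G) * (1 - ⟨(r : K), hrG⟩ * t)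
              = ⟨ξ, GeoDict.le_of_locChar hG1 hξW.fst⟩ - ⟨(r : K), hrG⟩ * (⟨ξ, GeoDict.le_of_locChar hG1 hξW.fst⟩ * t) := by
                ring
            _ = 0 := by rw [← ht, ← heqG, sub_self]
        have h2 := (mul_eq_zero.mp h1).resolve_left hξ0G
        exact (sub_eq_zero.mp h2).symm
      refine ⟨(t : K) * a, G.mul_mem t.2 (hRmG haR), ?_, ?_⟩
      · have hta : (t : K) * (r : K) = 1 := by
          have := congrArg Subtype.val hrt
          simpa [mul_comm] using this
        have ha0 : a ≠ 0 := by
          rintro rfl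
          exact hxm.2.1 (by rw [hxa, mul_zero])
        have hw : ((t : K) * a) * ((r : K) * a⁻¹) = 1 :=
          calc ((t : K) * a) * ((r : K) * a⁻¹) = ((t : K) * r) * (a * a⁻¹) := by ring
            _ = 1 := by rw [hta, mul_inv_cancel₀ ha0, one_mul]
        rw [inv_eq_of_mul_eq_one_right hw]
        exact G.mul_mem hrG (hRmG hainv)
      · rw [hxa]
        have := congrArg Subtype.val ht
        simp only [Subring.coe_mul] at this
        change (π : K) = ξ * (t : K) at this
        rw [this]; ring
  · -- ### CASE `ξ ∉ P m`: impossible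
    exfalso
    -- the local ring `D = (R m)_{P m}` of the hit
    obtain ⟨D, hD⟩ := GeoDict.exists_locChar Rm Pm
    haveI : IsLocalRing D := GeoDict.isLocalRing_of_locChar hD
    have hRmD : Rm ≤ D := GeoDict.le_of_locChar hD
    have hGD : G ≤ D := by
      intro z hz
      obtain ⟨a', b', hb', rfl⟩ := (hGm z).mp hz
      exact (hD _).mpr ⟨a', b', fun h => hb' (hPW h), rfl⟩
    -- `D = G_𝔮`, `𝔮 = 𝔪_D ∩ G`
    have hDG := locChar_of_locChar_le hD hRmG hGD
    set 𝔮 : Ideal G := (maximalIdeal D).comap (Subring.inclusion hGD) with h𝔮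
    haveI : 𝔮.IsPrime := Ideal.comap_isPrime _ _
    -- `D = (R (v+1))_{Q₁}`, `Q₁ = 𝔪_D ∩ R (v+1)`
    have hD1 := locChar_trans hG1 hDG
    set Q₁ : Ideal Rv1 := (maximalIdeal D).comap
      (Subring.inclusion ((GeoDict.le_of_locChar hG1).trans (GeoDict.le_of_locChar hDG))) with hQ₁
    haveI : Q₁.IsPrime := Ideal.comap_isPrime _ _
    -- `ξ ∉ 𝔪_D` (else `ξ ∈ 𝔪_D ∩ R m = P m`)
    have hξmaxD : (⟨ξ, hRmD hξRm⟩ : D) ∉ maximalIdeal D := by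
      intro h
      apply hξP
      have := (inclusion_mem_comap_maximalIdeal_iff_of_locChar hD (le_refl Rm) hRmD ⟨ξ, hξRm⟩).mp
        (by rw [Ideal.mem_comap]; exact h)
      exact this
    have hRv1 : Rv ≤ Rv1 := hbl.isLocalBlowup.le
    have hξQ₁ : (⟨ξ, hRv1 hξRv⟩ : Rv1) ∉ Q₁ := by
      intro h
      rw [hQ₁, Ideal.mem_comap] at h
      exact hξmaxD h
    -- off the exceptional prime: `D = (R v)_{Q'}`, `Q' = Q₁ ∩ R v`
    have hDv := locChar_eq_of_not_mem_excPrime hbl hξ hRv1 hξQ₁ hD1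
    set Q' : Ideal Rv := Q₁.comap (Subring.inclusion hRv1) with hQ'
    haveI : Q'.IsPrime := Ideal.comap_isPrime _ _
    -- `Q' < P v`
    have hQ'le : Q' ≤ Pv := by
      intro r hr
      rw [hQ', Ideal.mem_comap, hQ₁, Ideal.mem_comap] at hr
      -- `r ∈ 𝔪_D ∩ R m = P m ≤ W m`, and `W m ∩ R v = P v`
      have hrPm : Subring.inclusion hRvm r ∈ Pm :=
        (inclusion_mem_comap_maximalIdeal_iff_of_locChar hD (le_refl Rm) hRmD (Subring.inclusion hRvm r)).mp
          (by rw [Ideal.mem_comap]; exact hr)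
      rw [← hWmv, Ideal.mem_comap]
      exact hPW hrPm
    have hQ'lt : Q' < Pv := by
      refine lt_of_le_of_ne hQ'le fun heq => hξQ₁ ?_
      have : (⟨ξ, hξRv⟩ : Rv) ∈ Q' := heq ▸ hξPv
      rw [hQ', Ideal.mem_comap] at this
      exact this
    -- `T^p = s v^p` is regular over `D`
    have hregv : IsRegularLocalRing (AdjoinRoot ((X : D[X]) ^ p -
        C (⟨((⟨sv ^ p, hsv⟩ : Rv) : K), GeoDict.le_of_locChar hDv (⟨sv ^ p, hsv⟩ : Rv).2⟩ : D))) :=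
      (isRegularLocalRing_adjoinRoot_iff_of_locChar hDv p ⟨sv ^ p, hsv⟩).mp (hmin Q' hQ'lt)
    -- the unit `u = U ξ^(n+1)` of `D` and the rescaling `s m^p = (u⁻¹)^p s v^p + (−B u⁻¹)^p`
    have hUD : U ∈ D := hGD hU
    have hξD : ξ ∈ D := hRmD hξRm
    have hξinvD : ξ⁻¹ ∈ D := by
      have hunit : IsUnit (⟨ξ, hξD⟩ : D) := by
        by_contra h
        exact hξmaxD ((IsLocalRing.mem_maximalIdeal _).mpr h)
      exact ((isUnit_subring_iff_inv_mem _).mp hunit).2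
    set uinv : K := U⁻¹ * ξ⁻¹ ^ (n + 1) with huinv
    have huinvD : uinv ∈ D := D.mul_mem (hGD hUinv) (D.pow_mem hξinvD _)
    have hBD : B ∈ D := hRmD hB
    have hsmD : sm ^ p ∈ D := hRmD hsm
    have hunit : IsUnit (⟨uinv, huinvD⟩ : D) := by
      refine (isUnit_subring_iff_inv_mem _).mpr ⟨?_, ?_⟩
      · exact mul_ne_zero (inv_ne_zero hU0) (pow_ne_zero _ (inv_ne_zero hξ0))
      · change uinv⁻¹ ∈ D
        rw [huinv, inv_pow, mul_inv, inv_inv, inv_inv]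
        exact D.mul_mem hUD (D.pow_mem hξD _)
    have hf' : (⟨sm ^ p, hsmD⟩ : D) = ⟨uinv, huinvD⟩ ^ p *
        ⟨((⟨sv ^ p, hsv⟩ : Rv) : K), GeoDict.le_of_locChar hDv (⟨sv ^ p, hsv⟩ : Rv).2⟩ + ⟨-(B * uinv), D.neg_mem (D.mul_mem hBD huinvD)⟩ ^ p := by
      apply Subtype.ext
      simp only [Subring.coe_mul, Subring.coe_pow, Subring.coe_add]
      change sm ^ p = uinv ^ p * sv ^ p + (-(B * uinv)) ^ p
      have hne : U * ξ ^ (n + 1) ≠ 0 := mul_ne_zero hU0 (pow_ne_zero _ hξ0)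
      have huinv' : uinv = (U * ξ ^ (n + 1))⁻¹ := by rw [huinv, mul_inv, inv_pow]
      have hsm' : sm = uinv * sv + -(B * uinv) := by
        rw [huinv', hrel]
        field_simp
        ring
      rw [hsm', add_pow_char, mul_pow]
    have hregm : IsRegularLocalRing (AdjoinRoot ((X : D[X]) ^ p - C (⟨sm ^ p, hsmD⟩ : D))) :=
      ThreadChain.isRegularLocalRing_adjoinRoot_rescale p hunit hf' hregv
    exact hsing ((isRegularLocalRing_adjoinRoot_iff_of_locChar hD p ⟨sm ^ p, hsm⟩).mpr hregm)

end Hit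

end Summit.ResolutionOfSingularities.ResolutionOfSingularities.Theorems.SwitchingDichotomy.StrippedThread

end
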